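import Mathlib
import Summits.ValiantsHypothesis.ValiantsHypothesis.Theorems.ValuativeGCTValuativeFlipCyclicPencilAdjugate

/-!
# Ternary arc spanning: `x_t · (cofactors of the cyclic pencil)` span all ternary forms of degree `m`

Crux `ValuativeGCT.ValuativeFlip` (stmt-ValiantsHypothesis-12624), wall-breaker axis D
("det-orbit-closure multiplicity bounds for detCensus", seat k3 gen 1), second file of the chain
discharging row 3 of the few-row table (every ternary form of degree `m` lies in `Δ(det_m)`), over
`ValuativeGCTValuativeFlipCyclicPencilAdjugate`.

With `R = K[x, y, z]` (`x = X 0`, `y = X 1`, `z = X 2`), pairwise distinct scalars `η₀, …, ηₙ` and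
weights `wᵢ = x − ηᵢ y`, the cyclic pencil `M₀ = z·1 − X_w` is a determinantal representation of the
smooth plane curve `z^{n+1} = ∏ (x − ηᵢ y)` whose cofactors are the single products
`z^{n-k} · ∏_{s<k} w_{i+s}` (previous file).  Here:
* `X_pow_mul_X_pow_mem_span_arc` — ARC SPANNING: for `k ≤ n` the `n + 1` arcs
  `∏_{s<k} (x − η_{i+s} y)` span the binary forms of degree `k` (induction on `k`: consecutive arcs
  of length `k + 1` differ by `(η_{i+k+1} − η_i) · y · (arc of length k)`, a nonzero multiple since
  `η` is injective and `k + 1 ≤ n`);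
* `monomial_mem_span_X_mul_adjugate_cyclicPencil` — consequently EVERY ternary monomial of degree
  `n + 1` lies in the `K`-span of the products `x_t · (adj M₀)_{j i}`; in other words the
  differential of `(A₀, A₁, A₂) ↦ det (A₀ x + A₁ y + A₂ z)` at `M₀` (whose image is spanned by these
  products, Jacobi's formula) is ONTO the space of ternary forms of degree `n + 1`.  The next file
  turns this into the algebraic independence of the coefficients of the determinant of the generic
  ternary pencil (Jacobian criterion), i.e. Zariski density of determinantal ternary forms
  (Dickson 1921: the general ternary form of every degree is determinantal).

References: L. E. Dickson, Trans. AMS 22 (1921) 167–179; A. Beauville, *Determinantal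
hypersurfaces*, Michigan Math. J. 48 (2000); elementary [folklore].
-/

-- `Summit.ValiantsHypothesis.ValiantsHypothesis.…` is the tree's mandated single-conjunct layout (Sub = Summit).
set_option linter.dupNamespace false

namespace Summit.ValiantsHypothesis.ValiantsHypothesis.Theorems.ValuativeFlip

open scoped BigOperators Matrix
open Finset
open Fin.CommRing  -- `Fin (n+1)` as a commutative ring (scoped Mathlib instance): cyclic index arithmetic

noncomputable section

/-! ## Ternary arc spanning: the cofactors of the cyclic pencil, multiplied by the three variables,
span all ternary forms of degree `n + 1` -/

section ArcSpan

open MvPolynomial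

variable {K : Type*} [Field K] {n : ℕ}

/-- `cshift⟦w⟧`, the weighted cyclic shift `X_w` (as in `ValuativeGCTValuativeFlipCyclicPencilAdjugate`). -/
local notation3 (prettyPrint := false) "cshift⟦" w "⟧" =>
  (Matrix.of fun i j => if j = i + 1 then w i else 0)

/-- `arc⟦w, i, k⟧`, the arc product `wᵢ wᵢ₊₁ ⋯ wᵢ₊ₖ₋₁` (as in `…CyclicPencilAdjugate`). -/
local notation3 (prettyPrint := false) "arc⟦" w ", " i ", " k "⟧" =>
  (∏ s ∈ Finset.range k, w (i + Nat.cast s))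

/-- `wt⟦η⟧`: the weights `wᵢ = x − ηᵢ y` of the ternary cyclic pencil (`x = X 0`, `y = X 1`). -/
local notation3 (prettyPrint := false) "wt⟦" η "⟧" =>
  (fun i => (MvPolynomial.X 0 - MvPolynomial.C (η i) * MvPolynomial.X 1 : MvPolynomial (Fin 3) _))

/-- Two arcs of length `k + 1` starting at consecutive points differ by `(η_{j+1+k} − η_j) · y` times
the common arc of length `k`. [folklore] -/
theorem arc_sub_arc_succ (η : Fin (n + 1) → K) (j : Fin (n + 1)) (k : ℕ) :
    (arc⟦wt⟦η⟧, j, k + 1⟧ : MvPolynomial (Fin 3) K) - arc⟦wt⟦η⟧, j + 1, k + 1⟧ =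
      C (η (j + 1 + (k : Fin (n + 1))) - η j) * (X 1 * arc⟦wt⟦η⟧, j + 1, k⟧) := by
  rw [arcProd_succ' (wt⟦η⟧) j k, arcProd_succ (wt⟦η⟧) (j + 1) k]
  simp only [map_sub]
  ring

/-- Hence `y · (arc of length k)` lies in the span of the arcs of length `k + 1` (`k + 1 ≤ n`,
`η` injective). [folklore] -/
theorem X_one_mul_arc_mem_span (η : Fin (n + 1) → K) (hη : Function.Injective η) (j : Fin (n + 1))
    {k : ℕ} (hk : k + 1 < n + 1) :
    (X 1 : MvPolynomial (Fin 3) K) * arc⟦wt⟦η⟧, j + 1, k⟧ ∈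
      Submodule.span K (Set.range fun i : Fin (n + 1) => (arc⟦wt⟦η⟧, i, k + 1⟧ : MvPolynomial (Fin 3) K)) := by
  have hne : η (j + 1 + (k : Fin (n + 1))) - η j ≠ 0 := by
    intro h
    have h1 := hη (sub_eq_zero.mp h)
    have h2 : (1 : Fin (n + 1)) + (k : Fin (n + 1)) = 0 := by
      calc (1 : Fin (n + 1)) + (k : Fin (n + 1)) = (j + 1 + (k : Fin (n + 1))) - j := by ring
        _ = 0 := by rw [h1, sub_self]
    have h3 : ((k + 1 : ℕ) : Fin (n + 1)) = 0 := by
      rw [Nat.cast_succ]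
      exact (add_comm _ _).trans h2
    rw [Fin.natCast_eq_zero] at h3
    exact absurd (Nat.le_of_dvd (Nat.succ_pos k) h3) (by omega)
  have hmem : C (η (j + 1 + (k : Fin (n + 1))) - η j)⁻¹ *
      ((arc⟦wt⟦η⟧, j, k + 1⟧ : MvPolynomial (Fin 3) K) - arc⟦wt⟦η⟧, j + 1, k + 1⟧) ∈
      Submodule.span K (Set.range fun i : Fin (n + 1) => (arc⟦wt⟦η⟧, i, k + 1⟧ : MvPolynomial (Fin 3) K)) := by
    rw [← smul_eq_C_mul]
    refine Submodule.smul_mem _ _ (Submodule.sub_mem _ ?_ ?_)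
    · exact Submodule.subset_span ⟨j, rfl⟩
    · exact Submodule.subset_span ⟨j + 1, rfl⟩
  rw [arc_sub_arc_succ, ← mul_assoc, ← map_mul, inv_mul_cancel₀ hne, map_one, one_mul] at hmem
  exact hmem

/-- And `x · (arc of length k)` lies in the span of the arcs of length `k + 1` as well. [folklore] -/
theorem X_zero_mul_arc_mem_span (η : Fin (n + 1) → K) (hη : Function.Injective η) (j : Fin (n + 1))
    {k : ℕ} (hk : k + 1 < n + 1) :
    (X 0 : MvPolynomial (Fin 3) K) * arc⟦wt⟦η⟧, j + 1, k⟧ ∈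
      Submodule.span K (Set.range fun i : Fin (n + 1) => (arc⟦wt⟦η⟧, i, k + 1⟧ : MvPolynomial (Fin 3) K)) := by
  have h : (X 0 : MvPolynomial (Fin 3) K) * arc⟦wt⟦η⟧, j + 1, k⟧ =
      arc⟦wt⟦η⟧, j, k + 1⟧ + η j • ((X 1 : MvPolynomial (Fin 3) K) * arc⟦wt⟦η⟧, j + 1, k⟧) := by
    rw [arcProd_succ' (wt⟦η⟧) j k, smul_eq_C_mul]
    ring
  rw [h]
  exact Submodule.add_mem _ (Submodule.subset_span ⟨j, rfl⟩)
    (Submodule.smul_mem _ _ (X_one_mul_arc_mem_span η hη j hk))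

/-- **Arc spanning.** For injective `η` and `k ≤ n`, every binary monomial `x^a y^b` with
`a + b = k` lies in the `K`-span of the arcs `∏_{s<k} (x − η_{i+s} y)` of length `k`
(induction on `k`: `Bin_k = x·Bin_{k-1} + y·Bin_{k-1}`). [folklore] -/
theorem X_pow_mul_X_pow_mem_span_arc (η : Fin (n + 1) → K) (hη : Function.Injective η) :
    ∀ {k : ℕ}, k < n + 1 → ∀ {a b : ℕ}, a + b = k →
      (X 0 : MvPolynomial (Fin 3) K) ^ a * X 1 ^ b ∈
        Submodule.span K (Set.range fun i : Fin (n + 1) => (arc⟦wt⟦η⟧, i, k⟧ : MvPolynomial (Fin 3) K)) := by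
  intro k
  induction k with
  | zero =>
    intro _ a b hab
    obtain ⟨rfl, rfl⟩ : a = 0 ∧ b = 0 := by omega
    simp only [pow_zero, mul_one]
    exact Submodule.subset_span ⟨0, by simp⟩
  | succ k ih =>
    intro hk a b hab
    -- every arc of length `k` times `x` or `y` lies in the span of the arcs of length `k + 1`
    have hW : ∀ t : Fin 3, t ≠ 2 → Submodule.span K (Set.range fun i : Fin (n + 1) =>
        (arc⟦wt⟦η⟧, i, k⟧ : MvPolynomial (Fin 3) K)) ≤
        (Submodule.span K (Set.range fun i : Fin (n + 1) =>
          (arc⟦wt⟦η⟧, i, k + 1⟧ : MvPolynomial (Fin 3) K))).comap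
          (LinearMap.mulLeft K (X t : MvPolynomial (Fin 3) K)) := by
      intro t ht
      refine Submodule.span_le.mpr (Set.range_subset_iff.mpr fun i => ?_)
      simp only [SetLike.mem_coe, Submodule.mem_comap, LinearMap.mulLeft_apply]
      have hi : i = (i - 1) + 1 := (sub_add_cancel i 1).symm
      rw [hi]
      fin_cases t
      · exact X_zero_mul_arc_mem_span η hη (i - 1) hk
      · exact X_one_mul_arc_mem_span η hη (i - 1) hk
      · exact absurd rfl ht
    rcases Nat.eq_zero_or_pos a with rfl | ha
    · -- `y^{k+1} = y · y^k`
      have hb : b = k + 1 := by omega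
      subst hb
      have := hW 1 (by decide) (ih (by omega) (a := 0) (b := k) (by omega))
      simpa [pow_succ', mul_comm, mul_assoc, mul_left_comm] using this
    · obtain ⟨a, rfl⟩ : ∃ a', a = a' + 1 := ⟨a - 1, by omega⟩
      have := hW 0 (by decide) (ih (by omega) (a := a) (b := b) (by omega))
      simpa [pow_succ', mul_comm, mul_assoc, mul_left_comm] using this

/-- The determinant `z^{n+1} − ∏ (x − ηⱼ y)` of the ternary cyclic pencil is a nonzero polynomial
(it takes the value `1` at `(0, 0, 1)`). [folklore] -/
theorem cyclicPencil_det_ne_zero (η : Fin (n + 1) → K) :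
    (X 2 : MvPolynomial (Fin 3) K) ^ (n + 1) - ∏ j, (wt⟦η⟧) j ≠ 0 := by
  intro h
  have := congrArg (eval (fun t : Fin 3 => if t = 2 then (1 : K) else 0)) h
  simp only [map_sub, map_pow, eval_X, map_prod, map_mul, eval_C, map_zero] at this
  simp [Finset.prod_const, Finset.card_univ] at this

/-- **Every ternary monomial of degree `n + 1` lies in the span of `x_t · (cofactors of the cyclic
pencil)`** (`M₀ = z·1 − X_w`, `wᵢ = x − ηᵢ y`, `η` injective): `x^a y^b z^c = z · z^{c-1} x^a y^b`
with `x^a y^b` in the span of the arcs of length `a + b` and `z^{c-1} · arc = (adj M₀)_{i,i+a+b}`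
(`c ≥ 1`); for `c = 0` peel off `x` or `y` instead.  This is the surjectivity of the differential of
`(A₀, A₁, A₂) ↦ det (A₀ x + A₁ y + A₂ z)` at `M₀`. [folklore] -/
theorem monomial_mem_span_X_mul_adjugate_cyclicPencil {K : Type*} [Field K] {n : ℕ}
    (η : Fin (n + 1) → K) (hη : Function.Injective η) (e : Fin 3 →₀ ℕ) (he : e.degree = n + 1) :
    (MvPolynomial.monomial e (1 : K)) ∈ Submodule.span K (Set.range
      fun v : Fin 3 × Fin (n + 1) × Fin (n + 1) => (MvPolynomial.X v.1 : MvPolynomial (Fin 3) K) *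
        ((MvPolynomial.X 2 : MvPolynomial (Fin 3) K) •
            (1 : Matrix (Fin (n + 1)) (Fin (n + 1)) (MvPolynomial (Fin 3) K)) -
          Matrix.of fun i j : Fin (n + 1) => if j = i + 1 then
            (MvPolynomial.X 0 - MvPolynomial.C (η i) * MvPolynomial.X 1 : MvPolynomial (Fin 3) K)
            else 0).adjugate v.2.2 v.2.1) := by
  set M₀ : Matrix (Fin (n + 1)) (Fin (n + 1)) (MvPolynomial (Fin 3) K) :=
    (X 2 : MvPolynomial (Fin 3) K) • (1 : Matrix (Fin (n + 1)) (Fin (n + 1)) (MvPolynomial (Fin 3) K)) -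
      cshift⟦wt⟦η⟧⟧ with hM₀
  set V := Submodule.span K (Set.range fun v : Fin 3 × Fin (n + 1) × Fin (n + 1) =>
    (X v.1 : MvPolynomial (Fin 3) K) * M₀.adjugate v.2.2 v.2.1) with hV
  have hq := cyclicPencil_det_ne_zero (n := n) η
  -- the basic elements of `V`: `x_t · z^{n-k} · (binary form in the span of the arcs of length k)`
  have key : ∀ (t : Fin 3) {k : ℕ} (hk : k < n + 1) {p : MvPolynomial (Fin 3) K},
      p ∈ Submodule.span K (Set.range fun i : Fin (n + 1) => (arc⟦wt⟦η⟧, i, k⟧ : MvPolynomial (Fin 3) K)) →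
      (X t : MvPolynomial (Fin 3) K) * ((X 2 : MvPolynomial (Fin 3) K) ^ (n - k) * p) ∈ V := by
    intro t k hk p hp
    have hle : Submodule.span K (Set.range fun i : Fin (n + 1) =>
        (arc⟦wt⟦η⟧, i, k⟧ : MvPolynomial (Fin 3) K)) ≤
        V.comap (LinearMap.mulLeft K ((X t : MvPolynomial (Fin 3) K) * X 2 ^ (n - k))) := by
      refine Submodule.span_le.mpr (Set.range_subset_iff.mpr fun i => ?_)
      simp only [SetLike.mem_coe, Submodule.mem_comap, LinearMap.mulLeft_apply]
      rw [mul_assoc, ← adjugate_smul_one_sub_cyclicShift_apply_add (X 2) (wt⟦η⟧) hq i hk]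
      exact Submodule.subset_span ⟨(t, i + (k : Fin (n + 1)), i), rfl⟩
    have := hle hp
    simpa [mul_assoc] using this
  -- write the monomial as `x^a y^b z^c`
  have hmon : (monomial e (1 : K) : MvPolynomial (Fin 3) K) = X 0 ^ e 0 * X 1 ^ e 1 * X 2 ^ e 2 := by
    rw [monomial_eq, C_1, one_mul, Finsupp.prod_fintype _ _ (by simp), Fin.prod_univ_three]
  have hdeg : e 0 + e 1 + e 2 = n + 1 := by
    rw [← he, Finsupp.degree_eq_sum, Fin.sum_univ_three]
  rw [hmon]
  rcases Nat.eq_zero_or_pos (e 2) with h2 | h2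
  · -- `c = 0`
    rcases Nat.eq_zero_or_pos (e 0) with h0 | h0
    · -- `y^{n+1} = y · y^n`
      have h1 : e 1 = n + 1 := by omega
      have := key 1 (k := n) (by omega)
        (X_pow_mul_X_pow_mem_span_arc η hη (by omega) (a := 0) (b := n) (by omega))
      rw [h0, h1, h2]
      simpa [pow_succ', mul_comm, mul_assoc, mul_left_comm] using this
    · obtain ⟨a, ha⟩ : ∃ a, e 0 = a + 1 := ⟨e 0 - 1, by omega⟩
      have := key 0 (k := n) (by omega)
        (X_pow_mul_X_pow_mem_span_arc η hη (by omega) (a := a) (b := e 1) (by omega))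
      rw [ha, h2]
      simpa [pow_succ', mul_comm, mul_assoc, mul_left_comm] using this
  · obtain ⟨c, hc⟩ : ∃ c, e 2 = c + 1 := ⟨e 2 - 1, by omega⟩
    have := key 2 (k := e 0 + e 1) (by omega)
      (X_pow_mul_X_pow_mem_span_arc η hη (by omega) (a := e 0) (b := e 1) rfl)
    have hnk : n - (e 0 + e 1) = c := by omega
    rw [hnk] at this
    rw [hc]
    simpa [pow_succ', mul_comm, mul_assoc, mul_left_comm] using this

end ArcSpan

end

end Summit.ValiantsHypothesis.ValiantsHypothesis.Theorems.ValuativeFlip
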